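import Literature.Probability.Percolation.PercolationProofs
import Mathlib.Algebra.BigOperators.Group.Finset.Basic
import Mathlib.Data.Real.Basic
import Mathlib.Tactic.Linarith
import Mathlib.Tactic.Ring
import HarnessLib

/-!
# MIXED ≤ PURES: boosting both clusters at once costs at most the two one-sided boosts (prim-lf-2 gen 47)

Support file (`--supports stmt-CriticalPhenomena-4575`, closed), prover `prim-lf-2` (gen 47).  No definitions, no named facts, no sorries; standard axioms.
Memo `prim-lf-2/CW-QMIX-gen47.md` §5b (ATOM(2,2) of CONJECTURE FPC2 and its proof).

For monotone `f, g : Set V → ℝ` write `Φ(a,b) = (f a − f b)(g a − g b)` (the two-colouring summand with red cluster `a` and blue cluster `b`).  If `a ⊆ a'` (a RED boost) and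
`b ⊆ b'` (a BLUE boost) then, pointwise,
  `Φ(a',b') + Φ(a,b) − Φ(a',b) − Φ(a,b') = −(f a' − f a)(g b' − g b) − (f b' − f b)(g a' − g a) ≤ 0`
— the MIXED second difference of `Φ` is non-positive (`Coefficientwise.mixed_second_difference_nonpos`).  Summed over the colourings `s` of a finite multigraph with
`a = C_x(s)`, `b = C_x(sᶜ)` and the boosts given by sets `X` (red) and `Y` (blue) of SURE EDGES, this is
  `S_X^Y + S_∅^∅ ≤ S_X^∅ + S_∅^Y`,   `S_X^Y := Σ_s (f(C_x(ends '' s ∪ X)) − f(C_x(ends '' sᶜ ∪ Y)))·(g(…) − g(…))`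
(`Coefficientwise.sureEdges_mixed_le_pures`; `S_∅^∅ = H ≥ 0` is the two-colouring Harris sum, `S_X^∅, S_∅^Y ≥ 0` by gen 47's `offCluster_sureEdges_nonneg` with `A = ∅`, the mixed
`S_X^Y` is unsigned).  Consequence (memo §5b): with `P = {p₁p₂}`, `Q = {q₁q₂}`, `2·S_Q^P ≤ 2S_Q^∅ + 2S_∅^P − 2H ≤ S_∅^{P∪Q} + S_{P∪Q}^∅ + 2S_∅^P + 2S_Q^∅` — ATOM(2,2), i.e. the
proportional cell-pairing inequality FPC (hence FPC2) on every doubly-trivial double cell of CONJECTURE Q_mix with `deg p, deg q ≤ 2`; the general form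
`Coefficientwise.twoColouring_mixedBoost_le` takes arbitrary colouring-dependent boosts (gadget gluings).
[cite: KozmaNitzan2024, Questions 8–9 (§5.5 p. 36) (context: the Question-8 pocket covariance programme)]
-/

namespace Summit.CriticalPhenomena.PercolationContinuityZ3.Theorems

open Finset Literature.Probability.Percolation

namespace Coefficientwise

/-- **The mixed second difference is non-positive.**  For reals with `F ≤ F'`, `G ≤ G'` (red boost) and `B ≤ B'`, `C ≤ C'` (blue boost):
`(F' − B')(G' − C') + (F − B)(G − C) ≤ (F' − B)(G' − C) + (F − B')(G − C')` (the difference is `−(F'−F)(C'−C) − (B'−B)(G'−G)`).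
[cite: KozmaNitzan2024, §5.5 (context only; elementary)] -/
theorem mixed_second_difference_nonpos {F F' G G' B B' C C' : ℝ} (hF : F ≤ F') (hG : G ≤ G') (hB : B ≤ B') (hC : C ≤ C') :
    (F' - B') * (G' - C') + (F - B) * (G - C) ≤ (F' - B) * (G' - C) + (F - B') * (G - C') := by
  nlinarith [mul_nonneg (sub_nonneg.mpr hF) (sub_nonneg.mpr hC), mul_nonneg (sub_nonneg.mpr hB) (sub_nonneg.mpr hG)]

variable {ι V : Type*}

/-- **MIXED ≤ PURES for arbitrary boosts.**  For a finite index set of colourings `T`, monotone `f, g : Set V → ℝ`, and set-valued maps with `a s ⊆ a' s` (red boost),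
`b s ⊆ b' s` (blue boost) for `s ∈ T`:
`Σ_T Φ(a' s, b' s) + Σ_T Φ(a s, b s) ≤ Σ_T Φ(a' s, b s) + Σ_T Φ(a s, b' s)`, `Φ(a,b) = (f a − f b)(g a − g b)`.
[cite: KozmaNitzan2024, Questions 8–9 (§5.5 p. 36) (context)] -/
theorem twoColouring_mixedBoost_le (T : Finset (Finset ι)) (f g : Set V → ℝ) (hf : Monotone f) (hg : Monotone g)
    (a a' b b' : Finset ι → Set V) (ha : ∀ s ∈ T, a s ⊆ a' s) (hb : ∀ s ∈ T, b s ⊆ b' s) :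
    (∑ s ∈ T, (f (a' s) - f (b' s)) * (g (a' s) - g (b' s))) + ∑ s ∈ T, (f (a s) - f (b s)) * (g (a s) - g (b s)) ≤
      (∑ s ∈ T, (f (a' s) - f (b s)) * (g (a' s) - g (b s))) + ∑ s ∈ T, (f (a s) - f (b' s)) * (g (a s) - g (b' s)) := by
  rw [← Finset.sum_add_distrib, ← Finset.sum_add_distrib]
  exact Finset.sum_le_sum fun s hs =>
    mixed_second_difference_nonpos (hf (ha s hs)) (hg (ha s hs)) (hf (hb s hs)) (hg (hb s hs))

variable [Fintype ι] [DecidableEq ι]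

open Classical in
/-- **MIXED ≤ PURES for sure edges: `S_X^Y + S_∅^∅ ≤ S_X^∅ + S_∅^Y`.**  For a finite multigraph `ends : ι → Sym2 V`, root `x`, monotone `f, g`, and sets `X`, `Y ⊆ Sym2 V`
of extra edges always available to the RED resp. BLUE cluster (`C(s,X) = openCluster (ends '' s ∪ X) x`):
`Σ_s Φ(C(s,X), C(sᶜ,Y)) + Σ_s Φ(C(s,∅), C(sᶜ,∅)) ≤ Σ_s Φ(C(s,X), C(sᶜ,∅)) + Σ_s Φ(C(s,∅), C(sᶜ,Y))` (written with `ends '' s` for `C(s,∅)`).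
With `S_∅^∅ = H ≥ 0` (Harris) this gives `S_X^Y ≤ S_X^∅ + S_∅^Y`, and ATOM(2,2) of memo CW-QMIX-gen47 §5b.
[cite: KozmaNitzan2024, Questions 8–9 (§5.5 p. 36) (context)] -/
theorem sureEdges_mixed_le_pures (ends : ι → Sym2 V) (x : V) (X Y : Set (Sym2 V)) (f g : Set V → ℝ) (hf : Monotone f) (hg : Monotone g) :
    (∑ s : Finset ι, (f (openCluster (ends '' (↑s : Set ι) ∪ X) x) - f (openCluster (ends '' (↑(sᶜ) : Set ι) ∪ Y) x)) *
        (g (openCluster (ends '' (↑s : Set ι) ∪ X) x) - g (openCluster (ends '' (↑(sᶜ) : Set ι) ∪ Y) x))) +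
      ∑ s : Finset ι, (f (openCluster (ends '' (↑s : Set ι)) x) - f (openCluster (ends '' (↑(sᶜ) : Set ι)) x)) *
        (g (openCluster (ends '' (↑s : Set ι)) x) - g (openCluster (ends '' (↑(sᶜ) : Set ι)) x)) ≤
    (∑ s : Finset ι, (f (openCluster (ends '' (↑s : Set ι) ∪ X) x) - f (openCluster (ends '' (↑(sᶜ) : Set ι)) x)) *
        (g (openCluster (ends '' (↑s : Set ι) ∪ X) x) - g (openCluster (ends '' (↑(sᶜ) : Set ι)) x))) +
      ∑ s : Finset ι, (f (openCluster (ends '' (↑s : Set ι)) x) - f (openCluster (ends '' (↑(sᶜ) : Set ι) ∪ Y) x)) *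
        (g (openCluster (ends '' (↑s : Set ι)) x) - g (openCluster (ends '' (↑(sᶜ) : Set ι) ∪ Y) x)) :=
  twoColouring_mixedBoost_le (univ : Finset (Finset ι)) f g hf hg
    (fun s => openCluster (ends '' (↑s : Set ι)) x) (fun s => openCluster (ends '' (↑s : Set ι) ∪ X) x)
    (fun s => openCluster (ends '' (↑(sᶜ) : Set ι)) x) (fun s => openCluster (ends '' (↑(sᶜ) : Set ι) ∪ Y) x)
    (fun _ _ => openCluster_mono Set.subset_union_left x) (fun _ _ => openCluster_mono Set.subset_union_left x)

end Coefficientwise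

end Summit.CriticalPhenomena.PercolationContinuityZ3.Theorems
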